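import Mathlib.RingTheory.TensorProduct.Maps
import Mathlib.RingTheory.Ideal.Maps
import Mathlib.RingTheory.Ideal.Operations
import Mathlib.FieldTheory.Galois.Basic
import HarnessLib

/-!
# Crux `FrobeniusLadder.FRationalResolution` (stmt-ResolutionOfSingularities-15317), line `redirect`,
# stub `stub_diagonalizableQuotientResolution` — the SYMMETRIZED PIECE: decomposition-stability `hD` of the Galois route
# holds BY CONSTRUCTION for the product of the twists of any piece over the decomposition group

The scheme side of the Galois route (`…GaloisBaseChangeRegular.hasResolution_of_decomposition_stable_pieces'`) asks, at a
maximal `𝔔'` of `B ⊗_K K'`, for a `𝔔'`-primary piece `I` that is STABLE under the decomposition group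
`D = {σ ∈ Gal(K'/K) | (1 ⊗ σ) 𝔔' = 𝔔'}` (hypothesis `hD`) and has locally regular blow-up. Given ANY `𝔔'`-primary piece
`I₁` (e.g. the one produced from an étale chart and a residue embedding by `…GaloisUpstairsPiece.exists_piece_of_residue_
embedding` with `…GaloisResidueEmbeddingEtale`), the product of its twists over `D`,

  `I = ∏_{σ ∈ D} (1 ⊗ σ)(I₁)`,

is again `𝔔'`-primary (`𝔔'^{n·|D|} ⊆ I ⊆ I₁ ⊆ 𝔔'`) and satisfies `hD` with EQUALITY, by reindexing the product
(`(1 ⊗ τ)(1 ⊗ σ) = 1 ⊗ τσ` and `D` is closed under left multiplication). So `hD` is never the obstruction: what the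
route needs from the chart is exactly that the blow-up of this symmetrized piece is regular near `𝔔'` (on the split
toric side: the blow-up of the product of the Galois twists of the monomial centre — the common refinement of the
twisted fans when Galois acts through cone automorphisms).

* `twist_mul`, `twist_one`, `map_twist_map_twist` — multiplicativity of the twists `1 ⊗ σ` of `B ⊗_K K'`;
* `map_twist_prod_eq` — `(1 ⊗ τ)` permutes the factors of `∏_{σ ∈ D} (1 ⊗ σ)(I₁)` for `τ ∈ D`;
* **`exists_decomposition_stable_piece`** — from `𝔔'ⁿ ⊆ I₁ ⊆ 𝔔'`: a piece `I ⊆ I₁` with `𝔔'^m ⊆ I ⊆ 𝔔'`,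
  `(1 ⊗ σ) I = I` for every `σ ∈ D`, given by the displayed product formula.

Honest label: plumbing toward ONE leaf stub (no stub, crux or summit closed). No definitions, no named facts, no sorry.
[cite: StacksProject, Tag 09EB]
-/

noncomputable section

-- single-problem summit: the doubled namespace component is forced
set_option linter.dupNamespace false

open scoped TensorProduct

namespace Summit.ResolutionOfSingularities.ResolutionOfSingularities.Theorems.FRationalResolution.GaloisSymmetrizedPiece

variable {K B K' : Type} [Field K] [CommRing B] [Algebra K B] [Field K'] [Algebra K K']

/-- The twists are multiplicative: `(1 ⊗ τ) ∘ (1 ⊗ σ) = 1 ⊗ (τ * σ)`. [cite: StacksProject, Tag 09EB] -/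
theorem twist_mul (τ σ : K' ≃ₐ[K] K') :
    Algebra.TensorProduct.map (AlgHom.id B B) ((τ * σ : K' ≃ₐ[K] K') : K' →ₐ[K] K') =
      (Algebra.TensorProduct.map (AlgHom.id B B) (τ : K' →ₐ[K] K')).comp
        (Algebra.TensorProduct.map (AlgHom.id B B) (σ : K' →ₐ[K] K')) := by
  rw [← Algebra.TensorProduct.map_comp]
  rfl

/-- The trivial twist is the identity. [cite: StacksProject, Tag 09EB] -/
theorem twist_one :
    Algebra.TensorProduct.map (AlgHom.id B B) ((1 : K' ≃ₐ[K] K') : K' →ₐ[K] K') =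
      AlgHom.id B (B ⊗[K] K') := by
  rw [← Algebra.TensorProduct.map_id]
  rfl

/-- Twisting an ideal twice: `(1 ⊗ τ)((1 ⊗ σ) J) = (1 ⊗ τσ) J`. [cite: StacksProject, Tag 09EB] -/
theorem map_twist_map_twist (τ σ : K' ≃ₐ[K] K') (J : Ideal (B ⊗[K] K')) :
    (J.map (Algebra.TensorProduct.map (AlgHom.id B B) (σ : K' →ₐ[K] K'))).map
        (Algebra.TensorProduct.map (AlgHom.id B B) (τ : K' →ₐ[K] K')) =
      J.map (Algebra.TensorProduct.map (AlgHom.id B B) ((τ * σ : K' ≃ₐ[K] K') : K' →ₐ[K] K')) := by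
  have h := Ideal.map_map (I := J)
    (Algebra.TensorProduct.map (AlgHom.id B B) (σ : K' →ₐ[K] K') : B ⊗[K] K' →+* B ⊗[K] K')
    (Algebra.TensorProduct.map (AlgHom.id B B) (τ : K' →ₐ[K] K') : B ⊗[K] K' →+* B ⊗[K] K')
  rw [twist_mul]
  exact h

/-- **The twists permute the factors of the symmetrized product.** For a finite set `D` of automorphisms closed under
left multiplication by `τ` and by `τ⁻¹` (e.g. the decomposition group of `𝔔'`, `τ ∈ D`), `(1 ⊗ τ)` maps
`∏_{σ ∈ D} (1 ⊗ σ)(J)` ONTO itself. [cite: StacksProject, Tag 09EB] -/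
theorem map_twist_prod_eq (D : Finset (K' ≃ₐ[K] K')) (τ : K' ≃ₐ[K] K')
    (hD : ∀ σ ∈ D, τ * σ ∈ D) (hD' : ∀ σ ∈ D, τ⁻¹ * σ ∈ D) (J : Ideal (B ⊗[K] K')) :
    (∏ σ ∈ D, J.map (Algebra.TensorProduct.map (AlgHom.id B B) (σ : K' →ₐ[K] K'))).map
        (Algebra.TensorProduct.map (AlgHom.id B B) (τ : K' →ₐ[K] K')) =
      ∏ σ ∈ D, J.map (Algebra.TensorProduct.map (AlgHom.id B B) (σ : K' →ₐ[K] K')) := by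
  classical
  -- `Ideal.map` along a ring homomorphism is multiplicative
  have hmul := map_prod (Ideal.mapHom (Algebra.TensorProduct.map (AlgHom.id B B) (τ : K' →ₐ[K] K')))
    (fun σ : K' ≃ₐ[K] K' => J.map (Algebra.TensorProduct.map (AlgHom.id B B) (σ : K' →ₐ[K] K'))) D
  simp only [Ideal.mapHom_apply] at hmul
  rw [hmul]
  simp_rw [map_twist_map_twist]
  -- reindex the product by left multiplication with `τ`
  exact Finset.prod_bij' (fun σ _ => τ * σ) (fun σ _ => τ⁻¹ * σ) hD hD'
    (fun σ _ => inv_mul_cancel_left τ σ) (fun σ _ => mul_inv_cancel_left τ σ) (fun σ _ => rfl)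

/-- **THE SYMMETRIZED PIECE.** `K'/K` a finite extension, `𝔔'` an ideal of `B ⊗_K K'`, `I₁` a piece with
`𝔔'ⁿ ⊆ I₁ ⊆ 𝔔'`. Let `D` be the set of `σ ∈ Aut_K(K')` with `(1 ⊗ σ) 𝔔' = 𝔔'` (the decomposition group). Then
`I = ∏_{σ ∈ D} (1 ⊗ σ)(I₁)` satisfies `𝔔'^{n·|D|} ⊆ I ⊆ I₁ ⊆ 𝔔'` and `(1 ⊗ τ) I = I` for every `τ ∈ D` — in particular the
decomposition-stability hypothesis `hD` of `…GaloisBaseChangeRegular.hloc_of_decomposition_stable_piece'`.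
[cite: StacksProject, Tag 09EB] -/
theorem exists_decomposition_stable_piece [FiniteDimensional K K'] (𝔔' : Ideal (B ⊗[K] K'))
    (I₁ : Ideal (B ⊗[K] K')) {n : ℕ} (hn : 𝔔' ^ n ≤ I₁) (h₁ : I₁ ≤ 𝔔') :
    ∃ (D : Finset (K' ≃ₐ[K] K')) (m : ℕ),
      (∀ σ : K' ≃ₐ[K] K', σ ∈ D ↔ 𝔔'.map (Algebra.TensorProduct.map (AlgHom.id B B) (σ : K' →ₐ[K] K')) = 𝔔') ∧
      𝔔' ^ m ≤ ∏ σ ∈ D, I₁.map (Algebra.TensorProduct.map (AlgHom.id B B) (σ : K' →ₐ[K] K')) ∧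
      ∏ σ ∈ D, I₁.map (Algebra.TensorProduct.map (AlgHom.id B B) (σ : K' →ₐ[K] K')) ≤ I₁ ∧
      ∏ σ ∈ D, I₁.map (Algebra.TensorProduct.map (AlgHom.id B B) (σ : K' →ₐ[K] K')) ≤ 𝔔' ∧
      ∀ τ : K' ≃ₐ[K] K', 𝔔'.map (Algebra.TensorProduct.map (AlgHom.id B B) (τ : K' →ₐ[K] K')) = 𝔔' →
        (∏ σ ∈ D, I₁.map (Algebra.TensorProduct.map (AlgHom.id B B) (σ : K' →ₐ[K] K'))).map
            (Algebra.TensorProduct.map (AlgHom.id B B) (τ : K' →ₐ[K] K')) =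
          ∏ σ ∈ D, I₁.map (Algebra.TensorProduct.map (AlgHom.id B B) (σ : K' →ₐ[K] K')) := by
  classical
  set D : Finset (K' ≃ₐ[K] K') :=
    Finset.univ.filter fun σ => 𝔔'.map (Algebra.TensorProduct.map (AlgHom.id B B) (σ : K' →ₐ[K] K')) = 𝔔'
    with hDdef
  have hmemD : ∀ σ : K' ≃ₐ[K] K',
      σ ∈ D ↔ 𝔔'.map (Algebra.TensorProduct.map (AlgHom.id B B) (σ : K' →ₐ[K] K')) = 𝔔' := fun σ => by
    simp only [hDdef, Finset.mem_filter, Finset.mem_univ, true_and]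
  -- `D` is closed under multiplication and contains the identity and inverses
  have hone : (1 : K' ≃ₐ[K] K') ∈ D := by
    rw [hmemD, twist_one]
    exact Ideal.map_id _
  have hmulD : ∀ τ ∈ D, ∀ σ ∈ D, τ * σ ∈ D := fun τ hτ σ hσ => by
    rw [hmemD] at hτ hσ ⊢
    rw [← map_twist_map_twist, hσ, hτ]
  have hinvD : ∀ τ ∈ D, τ⁻¹ ∈ D := fun τ hτ => by
    rw [hmemD] at hτ ⊢
    conv_lhs => rw [← hτ]
    rw [map_twist_map_twist, inv_mul_cancel, twist_one]
    exact Ideal.map_id _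
  have hle : ∏ σ ∈ D, I₁.map (Algebra.TensorProduct.map (AlgHom.id B B) (σ : K' →ₐ[K] K')) ≤ I₁ := by
    -- the factor at `σ = 1` is `I₁`
    refine le_trans Ideal.prod_le_inf ?_
    refine le_trans (Finset.inf_le hone) ?_
    rw [twist_one]
    exact le_of_eq (Ideal.map_id _)
  refine ⟨D, n * D.card, hmemD, ?_, hle, hle.trans h₁, fun τ hτ => ?_⟩
  · -- `𝔔'^{n·|D|} = ∏_{σ ∈ D} 𝔔'ⁿ ≤ ∏_{σ ∈ D} (1 ⊗ σ)(I₁)` since `(1 ⊗ σ)(I₁) ⊇ (1 ⊗ σ)(𝔔'ⁿ) = 𝔔'ⁿ` for `σ ∈ D`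
    rw [pow_mul, ← Finset.prod_const]
    refine Finset.prod_le_prod' fun σ hσ => ?_
    rw [← (hmemD σ).mp hσ, ← Ideal.map_pow]
    exact Ideal.map_mono hn
  · have hτD : τ ∈ D := (hmemD τ).mpr hτ
    exact map_twist_prod_eq D τ (hmulD τ hτD) (fun σ hσ => hmulD _ (hinvD τ hτD) σ hσ) I₁

end Summit.ResolutionOfSingularities.ResolutionOfSingularities.Theorems.FRationalResolution.GaloisSymmetrizedPiece

end
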